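import Literature.Computability.AlgebraicComplexity.BorderRankExtensionClassSieve
import Literature.Computability.AlgebraicComplexity.BorderRankExtensionTorusCert
import HarnessLib

/-!
# Extension sieve V — class certificates (sparse-polynomial Macaulay / points layer)

This file completes the kernel tool-chain for the *torus rows* of the small-tensor border-rank
tables.  The weight-class spine `TorusCert.lt_algBorderRank_of_check`
(`BorderRankExtensionTorusCert`) reduces `r < bR(T)` for a torus-fixed concise tensor `T` to one
hypothesis per *open* weight class `m`:

  `hopen m : ∀ Z, (Z homogeneous of weight m) → Z ∉ T(A^*) → r < bR(T + e_new ⊗ Z)`.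

Here we discharge such a hypothesis by a **checkable certificate**.  Writing
`Z ≡ ∑_κ y_κ comp_κ (mod T(A^*))` on the `k`-dimensional class (`spanOk`, an explicit integer
identity), every role of the class sieve (`BorderRankExtensionClassSieve`: `(q,p)` Koszul–Young
flattenings in src/row position, slack `s ≤ 2`) yields linear forms in `y` whose
`(s+1) × (s+1)` minors vanish whenever `bR(T + e ⊗ Z) ≤ r` (`srcMinor_eq_zero` /
`rowMinor_eq_zero`).  The certificate then shows, by *sparse integer polynomial arithmetic that the
kernel can evaluate* (`Poly`, `pmul`, `ppow`, `pzero`, `pdet`), either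

* `macClassCheck`: every `y_i^N` lies in the ideal of these minors (explicit multipliers), so the
  only solution is `y = 0`, i.e. `Z ∈ T(A^*)` — contradiction (`hopen_of_macClassCheck`); or
* `ptsClassCheck`: products of linear forms vanishing on finitely many rational points lie (to a
  power) in the ideal, so `y` is proportional to one of the listed points, whose extension is a
  *child tensor* with `r < bR` supplied as a hypothesis (`hopen_of_ptsClassCheck`).

Everything is generic in the dimensions and in `(q,p)`; nothing is specific to one tensor.
HONEST FRAMING: this is bookkeeping for decidable certificates of border-rank lower bounds of
specific small tensors (a published-style computation made kernel-checkable) — a THEOREM /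
CERTIFICATE tool, not progress on the exponent of matrix multiplication.

References: Landsberg–Ottaviani, *Equations for secant varieties of Veronese and other
varieties*, Ann. Mat. Pura Appl. 192 (2013) / Thm. 2.1 of the Koszul–Young flattening bound
[LandsbergOttaviani2015]; Jagiella–Jelisiejew, *Unrestrictions* (2026), Thm. 1.8, Thm. 2.2
[JagiellaJelisiejew2026Unrestrictions]; Landsberg, *Geometry and complexity theory* (2017),
§2.4.2 [LandsbergGCT2017].
-/

open scoped BigOperators Matrix
open Matrix

namespace Literature.Computability.AlgebraicComplexity

namespace ClassSieve

universe u

/-! ## D. Sparse integer polynomials in `k` variables (certificate arithmetic) -/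

/-- A sparse polynomial: a list of terms `(c, e)` = `c · ∏_i y_i^{e_i}` (exponent of variable `i` is
`e.getD i 0`). [folklore] -/
abbrev Poly : Type := List (ℤ × List ℕ)

section PolyDefs

/-- Normalised exponent vector of length `k`. [folklore] -/
def enorm (k : ℕ) (e : List ℕ) : List ℕ := (List.range k).map fun i => e.getD i 0

/-- Sum of exponent vectors, normalised to length `k`. [folklore] -/
def eadd (k : ℕ) (e f : List ℕ) : List ℕ := (List.range k).map fun i => e.getD i 0 + f.getD i 0

/-- The exponent vector of `y_i`. [folklore] -/
def eunit (k i : ℕ) : List ℕ := (List.range k).map fun j => if j = i then 1 else 0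

/-- Product of polynomials. [folklore] -/
def pmul (k : ℕ) (P Q : Poly) : Poly :=
  P.flatMap fun ce => Q.map fun df => (ce.1 * df.1, eadd k ce.2 df.2)

/-- Integer multiple. [folklore] -/
def pscale (c : ℤ) (P : Poly) : Poly := P.map fun de => (c * de.1, de.2)

/-- Sum of a list of polynomials (concatenation). [folklore] -/
def psum (L : List Poly) : Poly := L.flatMap id

/-- `P ^ N`. [folklore] -/
def ppow (k : ℕ) (P : Poly) : ℕ → Poly
  | 0 => [(1, [])]
  | N + 1 => pmul k (ppow k P N) P

/-- The linear form `∑_i λ_i y_i`. [folklore] -/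
def plin (k : ℕ) (lam : ℕ → ℤ) : Poly := (List.range k).map fun i => (lam i, eunit k i)

/-- Zero test: with fuel, split off the class of the head monomial, its coefficients must sum to `0`.
[folklore] -/
def pzeroAux (k : ℕ) : ℕ → Poly → Bool
  | 0, P => P.isEmpty
  | _ + 1, [] => true
  | fuel + 1, (c, e) :: P =>
    (c + ((P.filter fun df => enorm k df.2 == enorm k e).map Prod.fst).sum == 0) &&
      pzeroAux k fuel (P.filter fun df => !(enorm k df.2 == enorm k e))

/-- Zero test of a polynomial (as a polynomial FUNCTION in `k` variables). [folklore] -/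
def pzero (k : ℕ) (P : Poly) : Bool := pzeroAux k P.length P

/-- Determinant polynomial of a `1 × 1`, `2 × 2` or `3 × 3` matrix of polynomials (row-major list);
`[]` for other sizes. [folklore] -/
def pdet (k : ℕ) : List (List Poly) → Poly
  | [[a]] => a
  | [[a, b], [c, d]] => pmul k a d ++ pscale (-1) (pmul k b c)
  | [[a, b, c], [d, e, f], [g, h, i]] =>
    pmul k a (pmul k e i) ++ pscale (-1) (pmul k a (pmul k f h)) ++
      pscale (-1) (pmul k b (pmul k d i)) ++ pmul k b (pmul k f g) ++
      pmul k c (pmul k d h) ++ pscale (-1) (pmul k c (pmul k e g))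
  | _ => []

end PolyDefs

section PolySound

variable {K : Type u} [Field K] {k : ℕ}

/-- The monomial `∏_i y_i^{e_i}`. [folklore] -/
def mono (e : List ℕ) (y : Fin k → K) : K := ∏ i : Fin k, y i ^ e.getD i 0

/-- Evaluation of a sparse polynomial. [folklore] -/
def peval (P : Poly) (y : Fin k → K) : K := (P.map fun ce => (ce.1 : K) * mono ce.2 y).sum

/-- `getD` of a `List.range`-map. [folklore] -/
theorem getD_map_range {k : ℕ} (f : ℕ → ℕ) (i : Fin k) :
    ((List.range k).map f).getD i 0 = f i := by
  rw [List.getD_eq_getElem?_getD, List.getElem?_map, List.getElem?_range i.isLt]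
  rfl

/-- Normalising an exponent vector does not change its monomial. [folklore] -/
theorem mono_enorm (e : List ℕ) (y : Fin k → K) : mono (enorm k e) y = mono e y := by
  unfold mono enorm
  exact Finset.prod_congr rfl fun i _ => by rw [getD_map_range]

/-- The monomial of a sum of exponent vectors is the product. [folklore] -/
theorem mono_eadd (e f : List ℕ) (y : Fin k → K) : mono (eadd k e f) y = mono e y * mono f y := by
  unfold mono eadd
  rw [← Finset.prod_mul_distrib]
  exact Finset.prod_congr rfl fun i _ => by rw [getD_map_range, pow_add]

/-- The empty exponent vector is the monomial `1`. [folklore] -/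
theorem mono_nil (y : Fin k → K) : mono [] y = 1 := by
  unfold mono; simp

/-- The unit exponent vector `eunit k i` is the monomial `y_i`. [folklore] -/
theorem mono_eunit (i : Fin k) (y : Fin k → K) : mono (eunit k i) y = y i := by
  unfold mono eunit
  rw [Finset.prod_eq_single i]
  · rw [getD_map_range]; simp
  · intro j _ hj
    rw [getD_map_range]
    simp [Fin.val_eq_val, hj]
  · simp

/-- Evaluation of the empty polynomial. [folklore] -/
@[simp] theorem peval_nil (y : Fin k → K) : peval ([] : Poly) y = 0 := by simp [peval]

/-- Evaluation of a cons. [folklore] -/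
@[simp] theorem peval_cons (ce : ℤ × List ℕ) (P : Poly) (y : Fin k → K) :
    peval (ce :: P) y = (ce.1 : K) * mono ce.2 y + peval P y := by simp [peval]

/-- Evaluation is additive under append. [folklore] -/
@[simp] theorem peval_append (P Q : Poly) (y : Fin k → K) :
    peval (P ++ Q) y = peval P y + peval Q y := by
  simp [peval, List.map_append, List.sum_append]

/-- Evaluation of a scaled polynomial. [folklore] -/
theorem peval_pscale (c : ℤ) (P : Poly) (y : Fin k → K) :
    peval (pscale c P) y = (c : K) * peval P y := by
  induction P with
  | nil => simp [pscale]
  | cons de P ih =>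
    simp only [pscale, List.map_cons, peval_cons, Int.cast_mul] at ih ⊢
    rw [ih]; ring

/-- Evaluation of a polynomial multiplied by one term. [folklore] -/
theorem peval_map_mul (ce : ℤ × List ℕ) (Q : Poly) (y : Fin k → K) :
    peval (Q.map fun df => (ce.1 * df.1, eadd k ce.2 df.2)) y =
      (ce.1 : K) * mono ce.2 y * peval Q y := by
  induction Q with
  | nil => simp
  | cons df Q ih =>
    simp only [List.map_cons, peval_cons, Int.cast_mul, mono_eadd] at ih ⊢
    rw [ih]; ring

/-- Evaluation of a product. [folklore] -/
theorem peval_pmul (P Q : Poly) (y : Fin k → K) :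
    peval (pmul k P Q) y = peval P y * peval Q y := by
  induction P with
  | nil => simp [pmul]
  | cons ce P ih =>
    simp only [pmul, List.flatMap_cons] at ih ⊢
    rw [peval_append, ih, peval_map_mul, peval_cons]; ring

/-- Evaluation of a list sum. [folklore] -/
theorem peval_psum (L : List Poly) (y : Fin k → K) :
    peval (psum L) y = (L.map fun P => peval P y).sum := by
  induction L with
  | nil => simp [psum]
  | cons P L ih =>
    simp only [psum, List.flatMap_cons, id] at ih ⊢
    rw [peval_append, ih, List.map_cons, List.sum_cons]

/-- Evaluation of a power. [folklore] -/
theorem peval_ppow (P : Poly) (N : ℕ) (y : Fin k → K) :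
    peval (ppow k P N) y = peval P y ^ N := by
  induction N with
  | zero => simp [ppow, peval, mono_nil]
  | succ N ih => rw [ppow, peval_pmul, ih, pow_succ]

omit [Field K] in
/-- `((range n).map f).sum = ∑_{i : Fin n} f i`. [folklore] -/
theorem sum_map_range_eq {R : Type*} [AddCommMonoid R] (n : ℕ) (f : ℕ → R) :
    ((List.range n).map f).sum = ∑ i : Fin n, f i := by
  induction n with
  | zero => simp
  | succ n ih =>
    rw [List.range_succ, List.map_append, List.sum_append, ih, Fin.sum_univ_castSucc]
    simp

/-- Evaluation of the linear form `plin k lam` is `∑ κ, lam κ * y κ`. [folklore] -/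
theorem peval_plin (lam : ℕ → ℤ) (y : Fin k → K) :
    peval (plin k lam) y = ∑ i : Fin k, (lam i : K) * y i := by
  unfold plin peval
  rw [List.map_map, sum_map_range_eq]
  refine Finset.sum_congr rfl fun i _ => ?_
  simp only [Function.comp_apply, mono_eunit]

end PolySound


/-! ## D'. Soundness of the zero test and of the small determinants -/

section PolyZero

variable {K : Type u} [Field K] {k : ℕ}

/-- Splitting a polynomial by a predicate on its terms. [folklore] -/
theorem peval_filter_add (P : Poly) (pr : ℤ × List ℕ → Bool) (y : Fin k → K) :
    peval (P.filter pr) y + peval (P.filter fun t => !pr t) y = peval P y := by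
  induction P with
  | nil => simp [peval]
  | cons t P ih =>
    cases hpt : pr t
    · simp only [List.filter_cons, hpt, Bool.not_false, Bool.false_eq_true, ↓reduceIte]
      simp only [peval, List.map_cons, List.sum_cons] at ih ⊢
      rw [← ih]; ring
    · simp only [List.filter_cons, hpt, Bool.not_true, Bool.false_eq_true, ↓reduceIte]
      simp only [peval, List.map_cons, List.sum_cons] at ih ⊢
      rw [← ih]; ring

/-- All terms of `L` with the same normalised monomial as `e`: `peval L = (∑ coeffs) · y^e`.
[folklore] -/
theorem peval_sameClass (e : List ℕ) (L : Poly) (h : ∀ t ∈ L, enorm k t.2 = enorm k e)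
    (y : Fin k → K) : peval L y = (((L.map Prod.fst).sum : ℤ) : K) * mono e y := by
  induction L with
  | nil => simp
  | cons t L ih =>
    have ht : mono t.2 y = mono e y := by
      rw [← mono_enorm t.2, h t (by simp), mono_enorm]
    rw [peval_cons, ih fun t' ht' => h t' (by simp [ht']), ht, List.map_cons, List.sum_cons,
      Int.cast_add, add_mul]

/-- Soundness of `pzeroAux`. [folklore] -/
theorem peval_eq_zero_of_pzeroAux (y : Fin k → K) :
    ∀ (fuel : ℕ) (P : Poly), pzeroAux k fuel P = true → peval P y = 0 := by
  intro fuel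
  induction fuel with
  | zero =>
    intro P h
    simp only [pzeroAux, List.isEmpty_iff] at h
    subst h; simp
  | succ fuel ih =>
    intro P h
    match P, h with
    | [], _ => simp
    | (c, e) :: P, h =>
      simp only [pzeroAux, Bool.and_eq_true, beq_iff_eq] at h
      obtain ⟨h1, h2⟩ := h
      have hrest := ih _ h2
      have hsame := peval_sameClass (K := K) e
        (P.filter fun df => enorm k df.2 == enorm k e)
        (fun t ht => by simpa using (List.mem_filter.1 ht).2) y
      rw [peval_cons, ← peval_filter_add P (fun df => enorm k df.2 == enorm k e) y, hrest, hsame,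
        add_zero, ← add_mul, ← Int.cast_add, h1, Int.cast_zero, zero_mul]

/-- **Soundness of the zero test**: `pzero k P ⇒ P ≡ 0` as a function on `K^k`. [folklore] -/
theorem peval_eq_zero_of_pzero {P : Poly} (h : pzero k P = true) (y : Fin k → K) : peval P y = 0 :=
  peval_eq_zero_of_pzeroAux y _ _ h

/-- Soundness of `pdet` for sizes `1, 2, 3` (`s + 1` with `s ≤ 2`). [folklore] -/
theorem peval_pdet (s : ℕ) (hs : s ≤ 2) (E : ℕ → ℕ → Poly) (y : Fin k → K) :
    peval (pdet k ((List.range (s + 1)).map fun u => (List.range (s + 1)).map fun v => E u v)) y =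
      (Matrix.of fun u v : Fin (s + 1) => peval (E u v) y).det := by
  interval_cases s
  · simp [List.range_succ, pdet]
  · simp [List.range_succ, pdet, Matrix.det_fin_two, peval_pmul, peval_pscale]
    ring
  · simp [List.range_succ, pdet, Matrix.det_fin_three, peval_pmul, peval_pscale]
    ring

end PolyZero

/-! ## E. Role records of a weight class (tensor `T ∈ ℤ^a ⊗ ℤ^b ⊗ ℤ^c`, first factor extended) -/

/-- A role of the class sieve: `isRow` (new rows) or source (new columns); `sw` = wedge the THIRD
factor instead of the second; `(q,p)` Koszul parameters (`q` = dimension of the wedged factor);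
slack `s`; `n` certified independent rows with their row certificate; the kernel vectors on codes.
[folklore] -/
structure RoleRec where
  /-- new-rows role (`true`) or new-columns role (`false`) -/
  isRow : Bool
  /-- wedge the third factor (`true`) or the second (`false`) -/
  sw : Bool
  /-- Koszul parameter `p` -/
  p : ℕ
  /-- slack -/
  s : ℕ
  /-- number of certified independent rows of the old matrix -/
  n : ℕ
  /-- row certificate -/
  rows : List (List (ℕ × ℤ))
  /-- pivots -/
  piv : List ℕ
  /-- kernel vectors on codes -/
  kvs : List (List (ℕ × ℤ))

/-- A generator of the class: role index, `s+1` kernel-vector indices, `s+1` new-index codes.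
[folklore] -/
structure GenRec where
  /-- index into the role list -/
  role : ℕ
  /-- kernel-vector indices -/
  us : List ℕ
  /-- new-index (subset) codes -/
  vs : List ℕ

/-- A point of a `points` class: pivot coordinate, integer point, the child direction it names.
[folklore] -/
structure PtRec where
  /-- pivot coordinate `i₀` with `P i₀ ≠ 0` -/
  i0 : ℕ
  /-- the point `P ∈ ℤ^k` -/
  P : List ℤ
  /-- the child direction `z` (as `b × c` row lists): `Dz · z = ∑_κ P_κ comp_κ + ∑_i cz_i T_i` -/
  z : List (List ℤ)
  /-- nonzero multiplier of `z` -/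
  Dz : ℤ
  /-- slice coefficients -/
  cz : List ℤ

section ClassDefs

open KYCert KYGen KYMask TorusCert

/-- The default role (never passes a check). [folklore] -/
def dfltRole : RoleRec := ⟨false, false, 0, 0, 0, [], [], []⟩

/-- Component `κ` of the class basis as an integer `b × c` matrix. [folklore] -/
def cget (b c : ℕ) (comps : List (List (List ℤ))) (κ : ℕ) : Fin b → Fin c → ℤ :=
  fun j l => mget3 comps κ j l

variable (a : ℕ) [NeZero a]

/-- Role check on the arranged tensor `U ∈ ℤ^a ⊗ ℤ^q ⊗ ℤ^d` (second factor wedged). [folklore] -/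
def roleOkU (q d : ℕ) [NeZero q] [NeZero d] (U : Fin a → Fin q → Fin d → ℤ) (r : ℕ) (R : RoleRec) :
    Bool :=
  if h1 : (maskSet q ((validMasks q (R.p + 1)).getD 0 0)).card = R.p + 1 then
    if h2 : (maskSet q ((validMasks q R.p).getD 0 0)).card = R.p then
      if R.isRow then
        rowRoleOk q R.p a d ⟨_, h1⟩ ⟨_, h2⟩ U r R.s R.n R.rows R.piv &&
          R.kvs.all (rowKvOk q R.p a d ⟨_, h1⟩ ⟨_, h2⟩ U)
      else
        srcRoleOk q R.p a d ⟨_, h1⟩ ⟨_, h2⟩ U r R.s R.n R.rows R.piv &&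
          R.kvs.all (srcKvOk q R.p a d ⟨_, h1⟩ ⟨_, h2⟩ U)
    else false
  else false

/-- The integer linear form of role `R`, kernel vector `α`, new index `β`, on a direction
`C ∈ ℤ^{q × d}`. [folklore] -/
def lamU (q d : ℕ) [NeZero q] [NeZero d] (R : RoleRec) (α β : ℕ) (C : Fin q → Fin d → ℤ) : ℤ :=
  if h1 : (maskSet q ((validMasks q (R.p + 1)).getD 0 0)).card = R.p + 1 then
    if h2 : (maskSet q ((validMasks q R.p).getD 0 0)).card = R.p then
      if R.isRow then rowLam q R.p d ⟨_, h1⟩ ⟨_, h2⟩ (R.kvs.getD α []) β C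
      else srcLam q R.p d ⟨_, h1⟩ ⟨_, h2⟩ (R.kvs.getD α []) β C
    else 0
  else 0

/-- Role check on `T ∈ ℤ^a ⊗ ℤ^b ⊗ ℤ^c` (wedge the second factor, or the third if `R.sw`).
[folklore] -/
def roleOkT (b c : ℕ) [NeZero b] [NeZero c] (T : Fin a → Fin b → Fin c → ℤ) (r : ℕ) (R : RoleRec) :
    Bool :=
  if R.sw then roleOkU a c b (fun i l j => T i j l) r R else roleOkU a b c T r R

/-- The integer linear form on a direction `C ∈ ℤ^{b × c}`. [folklore] -/
def lamT (b c : ℕ) [NeZero b] [NeZero c] (R : RoleRec) (α β : ℕ) (C : Fin b → Fin c → ℤ) : ℤ :=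
  if R.sw then lamU c b R α β (fun l j => C j l) else lamU b c R α β C

/-- The generator polynomial in the class coordinates `y ∈ K^k`: the `(s+1)`-minor
`det [ L(α_u, β_v)(∑_κ y_κ comp_κ) ]`. [cite: LandsbergOttaviani2015, Thm 2.1] -/
def genPoly (k b c : ℕ) [NeZero b] [NeZero c] (comps : List (List (List ℤ))) (roles : List RoleRec)
    (g : GenRec) : Poly :=
  let R := roles.getD g.role dfltRole
  pdet k ((List.range (R.s + 1)).map fun u => (List.range (R.s + 1)).map fun v =>
    plin k fun κ => lamT b c R (g.us.getD u 0) (g.vs.getD v 0) (cget b c comps κ))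

/-- The generators are well formed: role index in range, slack `≤ 2`. [folklore] -/
def gensOk (roles : List RoleRec) (gens : List GenRec) : Bool :=
  gens.all fun g => decide (g.role < roles.length) && decide ((roles.getD g.role dfltRole).s ≤ 2)

/-- The components are supported on the pairs of weight `m`. [folklore] -/
def compsOk (b c k : ℕ) (wB wC : List ℕ) (m : ℕ) (comps : List (List (List ℤ))) : Bool :=
  (List.range k).all fun κ => (List.range b).all fun j => (List.range c).all fun l =>
    (wt wB wC j l == m) || (mget3 comps κ j l == 0)

/-- The identity `D · E_{jl} = ∑_i C[j][l][i] · (T_i)^{(m)} + ∑_κ L[j][l][κ] · comp_κ` on the pairs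
of weight `m`. [folklore] -/
def idCheckK (b c k : ℕ) [NeZero b] [NeZero c] (T : Fin a → Fin b → Fin c → ℤ) (wB wC : List ℕ)
    (m : ℕ) (D : ℤ) (C L comps : List (List (List ℤ))) (j l : ℕ) : Bool :=
  (List.range b).all fun j' => (List.range c).all fun l' =>
    (wt wB wC j' l' != m) ||
      ((if j' = j ∧ l' = l then D else 0) ==
        lsum a (fun i => mget3 C j l i * T (finCode a i) (finCode b j') (finCode c l')) +
          lsum k (fun κ => mget3 L j l κ * mget3 comps κ j' l'))

/-- The weight class `m` is spanned, modulo the slices, by the `k` components (with denominator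
`D`). [folklore] -/
def spanOk (b c k : ℕ) [NeZero b] [NeZero c] (T : Fin a → Fin b → Fin c → ℤ) (wB wC : List ℕ)
    (m : ℕ) (D : ℤ) (C L comps : List (List (List ℤ))) : Bool :=
  compsOk b c k wB wC m comps &&
    (List.range b).all fun j => (List.range c).all fun l =>
      (wt wB wC j l != m) || idCheckK a b c k T wB wC m D C L comps j l

/-- Macaulay certificate: for every coordinate `i`, `D₁ · y_i^N = ∑_g mult[i][g] · gen_g`.
[folklore] -/
def macOk (k N : ℕ) (D1 : ℤ) (gens : List Poly) (mults : List (List Poly)) : Bool :=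
  (List.range k).all fun i =>
    pzero k (pscale D1 (ppow k [(1, eunit k i)] N) ++
      pscale (-1) (psum ((List.range gens.length).map fun g =>
        pmul k ((mults.getD i []).getD g []) (gens.getD g []))))

/-- The form `P_{i₀} y_q - P_q y_{i₀}`. [folklore] -/
def hform (k : ℕ) (P : List ℤ) (i0 q : ℕ) : Poly :=
  plin k fun j => (if j = q then P.getD i0 0 else 0) - (if j = i0 then P.getD q 0 else 0)

/-- All choice functions `point ↦ coordinate ≠ i₀`. [folklore] -/
def allChoices (k : ℕ) : List PtRec → List (List ℕ)
  | [] => [[]]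
  | pt :: pts => ((List.range k).filter fun q => q != pt.i0).flatMap fun q =>
      (allChoices k pts).map fun ch => q :: ch

/-- `∏_j h_{j, q_j}`. [folklore] -/
def prodForms (k : ℕ) : List PtRec → List ℕ → Poly
  | pt :: pts, q :: qs => pmul k (hform k pt.P pt.i0 q) (prodForms k pts qs)
  | _, _ => [(1, [])]

/-- Points certificate: pivots valid, child directions are `∑_κ P_κ comp_κ`, and for every choice
`D₁ · (∏_j h_{j,q_j})^N = ∑_g mult_g · gen_g` for some listed `(choice, N, mults)`. [folklore] -/
def ptsOk (b c k : ℕ) [NeZero b] [NeZero c] (T : Fin a → Fin b → Fin c → ℤ) (D1 : ℤ)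
    (comps : List (List (List ℤ))) (gens : List Poly) (pts : List PtRec)
    (cert : List (List ℕ × ℕ × List Poly)) : Bool :=
  (pts.all fun pt => decide (pt.i0 < k) && (pt.P.getD pt.i0 0 != 0) && (pt.Dz != 0) &&
    (List.range b).all fun j => (List.range c).all fun l =>
      pt.Dz * mget pt.z j l == (lsum k fun κ => pt.P.getD κ 0 * mget3 comps κ j l) +
        lsum a fun i => pt.cz.getD i 0 * T (finCode a i) (finCode b j) (finCode c l)) &&
  (allChoices k pts).all fun ch => cert.any fun ce => (ce.1 == ch) &&
    pzero k (pscale D1 (ppow k (prodForms k pts ch) ce.2.1) ++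
      pscale (-1) (psum ((List.range gens.length).map fun g =>
        pmul k (ce.2.2.getD g []) (gens.getD g []))))

/-- **Check of a `macaulay` weight class** `m` of `T` (extension factor first, weights `wB, wC` on
the other two): span data, roles, generators, Macaulay identities. [folklore] -/
def macClassCheck (b c : ℕ) [NeZero b] [NeZero c] (T : Fin a → Fin b → Fin c → ℤ)
    (wB wC : List ℕ) (m r k : ℕ) (D : ℤ) (C L comps : List (List (List ℤ)))
    (roles : List RoleRec) (gens : List GenRec) (N : ℕ) (D1 : ℤ) (mults : List (List Poly)) :
    Bool :=
  spanOk a b c k T wB wC m D C L comps && roles.all (roleOkT a b c T r) && gensOk roles gens &&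
    macOk k N D1 (gens.map (genPoly k b c comps roles)) mults

/-- **Check of a `points` weight class.** [folklore] -/
def ptsClassCheck (b c : ℕ) [NeZero b] [NeZero c] (T : Fin a → Fin b → Fin c → ℤ)
    (wB wC : List ℕ) (m r k : ℕ) (D : ℤ) (C L comps : List (List (List ℤ)))
    (roles : List RoleRec) (gens : List GenRec) (D1 : ℤ) (pts : List PtRec)
    (cert : List (List ℕ × ℕ × List Poly)) : Bool :=
  spanOk a b c k T wB wC m D C L comps && roles.all (roleOkT a b c T r) && gensOk roles gens &&
    ptsOk a b c k T D1 comps (gens.map (genPoly k b c comps roles)) pts cert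

end ClassDefs

/-! ## F. Soundness -/

section ClassSound

open KYCert KYGen KYMask TorusCert SieveCert
open JLPCert (finCode_of_lt)

variable {K : Type u} [Field K]

variable {a : ℕ} [NeZero a]

/-- The `K`-linear form of a role on the arranged tensor. [folklore] -/
def lamUK (q d : ℕ) [NeZero q] [NeZero d] (R : RoleRec) (α β : ℕ) (Z : Fin q → Fin d → K) : K :=
  if h1 : (maskSet q ((validMasks q (R.p + 1)).getD 0 0)).card = R.p + 1 then
    if h2 : (maskSet q ((validMasks q R.p).getD 0 0)).card = R.p then
      if R.isRow then rowLamK (K := K) q R.p d ⟨_, h1⟩ ⟨_, h2⟩ (R.kvs.getD α []) β Z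
      else srcLamK (K := K) q R.p d ⟨_, h1⟩ ⟨_, h2⟩ (R.kvs.getD α []) β Z
    else 0
  else 0

/-- The `K`-linear form of a role on `Z ∈ K^{b × c}`. [folklore] -/
def lamTK (b c : ℕ) [NeZero b] [NeZero c] (R : RoleRec) (α β : ℕ) (Z : Fin b → Fin c → K) : K :=
  if R.sw then lamUK (K := K) c b R α β (fun l j => Z j l) else lamUK (K := K) b c R α β Z

/-- `lamUK` is additive over a finite sum of directions. [folklore] -/
theorem lamUK_sum (q d : ℕ) [NeZero q] [NeZero d] (R : RoleRec) (α β : ℕ) {k : ℕ}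
    (C : Fin k → Fin q → Fin d → ℤ) (y : Fin k → K) :
    lamUK (K := K) q d R α β (fun x l => ∑ i, y i * (C i x l : K)) =
      ∑ i, y i * (lamU q d R α β (C i) : K) := by
  unfold lamUK lamU
  split_ifs <;> simp [srcLamK_sum, rowLamK_sum]

/-- `lamTK` is additive over a finite sum of directions. [folklore] -/
theorem lamTK_sum (b c : ℕ) [NeZero b] [NeZero c] (R : RoleRec) (α β : ℕ) {k : ℕ}
    (C : Fin k → Fin b → Fin c → ℤ) (y : Fin k → K) :
    lamTK (K := K) b c R α β (fun j l => ∑ i, y i * (C i j l : K)) =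
      ∑ i, y i * (lamT b c R α β (C i) : K) := by
  unfold lamTK lamT
  split_ifs with hsw
  · exact lamUK_sum (K := K) c b R α β (fun i l j => C i j l) y
  · exact lamUK_sum (K := K) b c R α β C y

omit [NeZero a] in
/-- A `List.all` fact transfers to `getD` at an in-range index. [folklore] -/
theorem all_getD {P : List (ℕ × ℤ) → Bool} {L : List (List (ℕ × ℤ))} (h : L.all P = true)
    (h0 : P [] = true) (α : ℕ) : P (L.getD α []) = true := by
  rw [List.getD_eq_getElem?_getD]
  cases hα : L[α]? with
  | none => simpa using h0
  | some v =>
    simp only [Option.getD_some]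
    exact List.all_eq_true.1 h v (List.mem_of_getElem? hα)

/-- Role minors on the arranged tensor. [cite: LandsbergOttaviani2015, Thm 2.1] -/
theorem det_lamUK_eq_zero (q d : ℕ) [NeZero q] [NeZero d] (U : Fin a → Fin q → Fin d → ℤ) {r : ℕ}
    {R : RoleRec} (h : roleOkU a q d U r R = true) (Z : Fin q → Fin d → K)
    (hZ : algBorderRank (extendSlice (fun i j l => (U i j l : K)) Z) ≤ r)
    (us vs : Fin (R.s + 1) → ℕ) :
    (Matrix.of fun u v => lamUK (K := K) q d R (us u) (vs v) Z).det = 0 := by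
  classical
  unfold roleOkU at h
  by_cases h1 : (maskSet q ((validMasks q (R.p + 1)).getD 0 0)).card = R.p + 1
  · by_cases h2 : (maskSet q ((validMasks q R.p).getD 0 0)).card = R.p
    · rw [dif_pos h1, dif_pos h2] at h
      cases hrow : R.isRow
      · rw [hrow] at h
        simp only [Bool.false_eq_true, ↓reduceIte, Bool.and_eq_true] at h
        obtain ⟨hrole, hall⟩ := h
        have hkv : ∀ u, srcKvOk q R.p a d ⟨_, h1⟩ ⟨_, h2⟩ U (R.kvs.getD (us u) []) = true :=
          fun u => all_getD hall (by simp [srcKvOk]) _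
        have key := srcMinor_eq_zero (K := K) q R.p a d ⟨_, h1⟩ ⟨_, h2⟩ U hrole
          (fun u => R.kvs.getD (us u) []) hkv vs Z hZ
        rw [← key]
        congr 1
        ext u v
        simp only [Matrix.of_apply, lamUK]
        rw [dif_pos h1, dif_pos h2, hrow]
        simp
      · rw [hrow] at h
        simp only [↓reduceIte, Bool.and_eq_true] at h
        obtain ⟨hrole, hall⟩ := h
        have hkv : ∀ v, rowKvOk q R.p a d ⟨_, h1⟩ ⟨_, h2⟩ U (R.kvs.getD (us v) []) = true :=
          fun v => all_getD hall (by simp [rowKvOk]) _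
        have key := rowMinor_eq_zero (K := K) q R.p a d ⟨_, h1⟩ ⟨_, h2⟩ U hrole
          (fun v => R.kvs.getD (us v) []) hkv vs Z hZ
        rw [← Matrix.det_transpose, ← key]
        congr 1
        ext u v
        simp only [Matrix.transpose_apply, Matrix.of_apply, lamUK]
        rw [dif_pos h1, dif_pos h2, hrow]
        simp
    · rw [dif_pos h1, dif_neg h2] at h
      exact absurd h Bool.false_ne_true
  · rw [dif_neg h1] at h
    exact absurd h Bool.false_ne_true

omit [NeZero a] in
/-- Transposing the last two factors of an extension. [folklore] -/
theorem algBorderRank_extendSlice_swap {b c : ℕ} (t : Fin a → Fin b → Fin c → K)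
    (Z : Fin b → Fin c → K) :
    algBorderRank (extendSlice (fun i l j => t i j l) (fun l j => Z j l)) =
      algBorderRank (extendSlice t Z) := by
  have : extendSlice (fun i l j => t i j l) (fun l j => Z j l) =
      fun i l j => extendSlice t Z i j l := by
    funext i l j; cases i <;> rfl
  rw [this, algBorderRank_swap₂₃]

/-- Role minors on `T`. [cite: LandsbergOttaviani2015, Thm 2.1] -/
theorem det_lamTK_eq_zero (b c : ℕ) [NeZero b] [NeZero c] (T : Fin a → Fin b → Fin c → ℤ) {r : ℕ}
    {R : RoleRec} (h : roleOkT a b c T r R = true) (Z : Fin b → Fin c → K)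
    (hZ : algBorderRank (extendSlice (fun i j l => (T i j l : K)) Z) ≤ r)
    (us vs : Fin (R.s + 1) → ℕ) :
    (Matrix.of fun u v => lamTK (K := K) b c R (us u) (vs v) Z).det = 0 := by
  unfold roleOkT at h
  unfold lamTK
  cases hsw : R.sw
  · simp only [hsw, Bool.false_eq_true, ↓reduceIte] at h ⊢
    exact det_lamUK_eq_zero b c T h Z hZ us vs
  · simp only [hsw, ↓reduceIte] at h ⊢
    refine det_lamUK_eq_zero c b (fun i l j => T i j l) h (fun l j => Z j l) ?_ us vs
    rwa [algBorderRank_extendSlice_swap]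

/-- The class direction `Z(y) = ∑_κ y_κ comp_κ`. [folklore] -/
def zOf (b c k : ℕ) (comps : List (List (List ℤ))) (y : Fin k → K) : Fin b → Fin c → K :=
  fun j l => ∑ κ, y κ * (cget b c comps κ j l : K)

/-- `lamTK` of the parametrised direction `zOf y` is the `y`-combination of its values on the `comps`. [folklore] -/
theorem lamTK_zOf (b c k : ℕ) [NeZero b] [NeZero c] (R : RoleRec) (α β : ℕ)
    (comps : List (List (List ℤ))) (y : Fin k → K) :
    lamTK (K := K) b c R α β (zOf b c k comps y) =
      ∑ i, y i * (lamT b c R α β (cget b c comps i) : K) :=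
  lamTK_sum (K := K) b c R α β (fun i => cget b c comps i) y

/-- **Generators vanish**: if the roles pass and `bR(T + e_new ⊗ Z(y)) ≤ r`, every generator
polynomial vanishes at `y`. [cite: LandsbergOttaviani2015, Thm 2.1] -/
theorem peval_genPoly_eq_zero (b c k : ℕ) [NeZero b] [NeZero c] (T : Fin a → Fin b → Fin c → ℤ)
    {r : ℕ} (comps : List (List (List ℤ))) {roles : List RoleRec} {gens : List GenRec}
    (hroles : roles.all (roleOkT a b c T r) = true) (hgens : gensOk roles gens = true)
    (y : Fin k → K)
    (hZ : algBorderRank (extendSlice (fun i j l => (T i j l : K)) (zOf b c k comps y)) ≤ r) :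
    ∀ g ∈ gens, peval (genPoly k b c comps roles g) y = 0 := by
  classical
  intro g hg
  unfold gensOk at hgens
  rw [List.all_eq_true] at hgens hroles
  have hg' := hgens g hg
  simp only [Bool.and_eq_true, decide_eq_true_eq] at hg'
  obtain ⟨hlt, hs⟩ := hg'
  set R := roles.getD g.role dfltRole with hR
  have hRmem : R ∈ roles := by
    rw [hR, List.getD_eq_getElem?_getD, List.getElem?_eq_getElem hlt, Option.getD_some]
    exact List.getElem_mem hlt
  have hrole := hroles R hRmem
  unfold genPoly
  rw [← hR]
  simp only []
  rw [peval_pdet R.s hs]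
  have key := det_lamTK_eq_zero (K := K) b c T hrole (zOf b c k comps y) hZ
    (fun u => g.us.getD u 0) (fun v => g.vs.getD v 0)
  rw [← key]
  congr 1
  ext u v
  simp only [Matrix.of_apply, peval_plin]
  rw [lamTK_zOf]
  exact Finset.sum_congr rfl fun κ _ => mul_comm _ _

/-- `D • E_{jl} - ∑_κ L_{jlκ} • comp_κ ∈ T(A^*)` from the checked identity. [folklore] -/
theorem stdMat_sub_mem {b c k : ℕ} [NeZero b] [NeZero c] {T : Fin a → Fin b → Fin c → ℤ}
    {wA wB wC : List ℕ} {e0 : ℕ} (hhom : homogCheck a b c T wA wB wC e0 = true) {m : ℕ} {D : ℤ}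
    {C L comps : List (List (List ℤ))} (hcomps : compsOk b c k wB wC m comps = true)
    (j : Fin b) (l : Fin c) (hjl : wt wB wC j l = m)
    (hid : idCheckK a b c k T wB wC m D C L comps j l = true) :
    ((D : K) • (stdMat j l : Fin b → Fin c → K) -
        fun (j' : Fin b) (l' : Fin c) => ∑ κ : Fin k, ((mget3 L j l κ : ℤ) : K) * (mget3 comps κ j' l' : K)) ∈
      sliceSpan (fun i j l => ((T i j l : ℤ) : K)) := by
  classical
  set tK : Fin a → Fin b → Fin c → K := fun i j l => ((T i j l : ℤ) : K) with htK
  let ωB : Fin b → ℕ := fun j => nget wB j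
  let ωC : Fin c → ℕ := fun l => nget wC l
  have hhomK := hom_of_homogCheck (K := K) hhom
  have hf : ∀ {n : ℕ} [NeZero n] (i : Fin n), finCode n (i : ℕ) = i :=
    fun i => Fin.ext (Nat.mod_eq_of_lt i.isLt)
  have heq : ((D : K) • (stdMat j l : Fin b → Fin c → K) -
      fun (j' : Fin b) (l' : Fin c) => ∑ κ : Fin k, ((mget3 L j l κ : ℤ) : K) * (mget3 comps κ j' l' : K)) =
      ∑ i : Fin a, ((mget3 C j l i : ℤ) : K) • weightPart ωB ωC m (tK i) := by
    funext j' l'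
    simp only [Pi.sub_apply, Pi.smul_apply, smul_eq_mul, Finset.sum_apply, weightPart_apply,
      stdMat]
    by_cases hw : ωB j' + ωC l' = m
    · have h2 := of_all_range₂ (P := fun j' l' => (wt wB wC j' l' != m) ||
          ((if j' = (j : ℕ) ∧ l' = (l : ℕ) then D else 0) ==
            lsum a (fun i => mget3 C j l i * T (finCode a i) (finCode b j') (finCode c l')) +
              lsum k (fun κ => mget3 L j l κ * mget3 comps κ j' l'))) hid j' l'
      have hw' : wt wB wC j' l' = m := hw
      simp only [hw', bne_self_eq_false, Bool.false_or, beq_iff_eq, lsum_eq, hf] at h2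
      have h3 := congrArg (Int.cast : ℤ → K) h2
      simp only [Int.cast_add, Int.cast_mul, Int.cast_sum, apply_ite (Int.cast : ℤ → K),
        Int.cast_zero] at h3
      simp only [if_pos hw, Fin.ext_iff]
      rw [show (if (j' : ℕ) = j ∧ (l' : ℕ) = l then (D : K) else 0) =
        (D : K) * (if (j' : ℕ) = j ∧ (l' : ℕ) = l then 1 else 0) by split_ifs <;> simp] at h3
      rw [htK]
      linear_combination h3
    · have hne : ¬ (j' = j ∧ l' = l) := by
        rintro ⟨rfl, rfl⟩; exact hw hjl
      have hz0 : ∀ κ : Fin k, (mget3 comps κ j' l' : K) = 0 := by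
        intro κ
        unfold compsOk at hcomps
        rw [List.all_eq_true] at hcomps
        have h1 := of_all_range₂ (hcomps κ (List.mem_range.2 κ.isLt)) j' l'
        have hw' : wt wB wC j' l' ≠ m := hw
        simp only [Bool.or_eq_true, beq_iff_eq] at h1
        rcases h1 with h1 | h1
        · exact absurd h1 hw'
        · rw [h1, Int.cast_zero]
      simp [if_neg hne, if_neg hw, hz0]
  rw [heq]
  exact Submodule.sum_mem _ fun i _ =>
    Submodule.smul_mem _ _ (weightPart_mem_sliceSpan hhomK m (Submodule.subset_span ⟨i, rfl⟩))

/-- **Decomposition of the weight class**: a homogeneous `Z` of weight `m` is `Z(y) + v` with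
`v ∈ T(A^*)`. [folklore] -/
theorem exists_eq_zOf_add {b c k : ℕ} [NeZero b] [NeZero c] {T : Fin a → Fin b → Fin c → ℤ}
    {wA wB wC : List ℕ} {e0 : ℕ} (hhom : homogCheck a b c T wA wB wC e0 = true) {m : ℕ} {D : ℤ}
    (hD : (D : K) ≠ 0) {C L comps : List (List (List ℤ))}
    (hspan : spanOk a b c k T wB wC m D C L comps = true)
    (Z : Fin b → Fin c → K) (hZ : ∀ j l, Z j l ≠ 0 → nget wB j + nget wC l = m) :
    ∃ (y : Fin k → K) (v : Fin b → Fin c → K), v ∈ sliceSpan (fun i j l => ((T i j l : ℤ) : K)) ∧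
      Z = zOf b c k comps y + v := by
  classical
  unfold spanOk at hspan
  simp only [Bool.and_eq_true] at hspan
  obtain ⟨hcomps, hids⟩ := hspan
  set tK : Fin a → Fin b → Fin c → K := fun i j l => ((T i j l : ℤ) : K) with htK
  let cK : Fin k → Fin b → Fin c → K := fun κ j' l' => (mget3 comps κ j' l' : K)
  let vv : Fin b → Fin c → (Fin b → Fin c → K) := fun j l =>
    (D : K) • (stdMat j l : Fin b → Fin c → K) -
      fun (j' : Fin b) (l' : Fin c) => ∑ κ : Fin k, ((mget3 L j l κ : ℤ) : K) * cK κ j' l'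
  have hvV : ∀ (j : Fin b) (l : Fin c), wt wB wC j l = m → vv j l ∈ sliceSpan tK := by
    intro j l hjl
    have h1 := of_all_range₂ hids j l
    simp only [Bool.or_eq_true, bne_iff_ne, ne_eq] at h1
    rcases h1 with h1 | h1
    · exact absurd hjl h1
    · exact stdMat_sub_mem (K := K) hhom hcomps j l hjl h1
  -- coefficients
  let y' : Fin k → K := fun κ => ∑ j, ∑ l, Z j l * ((mget3 L j l κ : ℤ) : K)
  have hdec : (D : K) • Z = zOf b c k comps y' + ∑ j, ∑ l, Z j l • vv j l := by
    funext j' l'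
    have eS : (∑ j, ∑ l, Z j l • vv j l) j' l' = ∑ j, ∑ l, Z j l * vv j l j' l' := by
      simp only [Finset.sum_apply, Pi.smul_apply, smul_eq_mul]
    have eV : ∀ j l, vv j l j' l' = (D : K) * (if j' = j ∧ l' = l then 1 else 0) -
        ∑ κ : Fin k, ((mget3 L j l κ : ℤ) : K) * cK κ j' l' := by
      intro j l
      simp only [vv, Pi.sub_apply, Pi.smul_apply, smul_eq_mul, stdMat]
    have eA : ∑ j : Fin b, ∑ l : Fin c, Z j l * ((D : K) * (if j' = j ∧ l' = l then 1 else 0)) =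
        (D : K) * Z j' l' := by
      rw [Finset.sum_eq_single j']
      · rw [Finset.sum_eq_single l']
        · simp [mul_comm]
        · intro l _ hl; simp [Ne.symm hl]
        · intro h; exact absurd (Finset.mem_univ _) h
      · intro j _ hj
        exact Finset.sum_eq_zero fun l _ => by simp [Ne.symm hj]
      · intro h; exact absurd (Finset.mem_univ _) h
    have eB : zOf b c k comps y' j' l' =
        ∑ j : Fin b, ∑ l : Fin c, Z j l * ∑ κ : Fin k, ((mget3 L j l κ : ℤ) : K) * cK κ j' l' := by
      simp only [zOf, cget, y', cK, Finset.sum_mul, Finset.mul_sum]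
      rw [Finset.sum_comm]
      refine Finset.sum_congr rfl fun j _ => ?_
      rw [Finset.sum_comm]
      refine Finset.sum_congr rfl fun l _ => ?_
      refine Finset.sum_congr rfl fun κ _ => ?_
      ring
    simp only [Pi.add_apply, Pi.smul_apply, smul_eq_mul]
    rw [eS]
    simp only [eV, mul_sub, Finset.sum_sub_distrib]
    rw [eA, eB]
    ring
  have hmem : (∑ j, ∑ l, Z j l • vv j l) ∈ sliceSpan tK := by
    refine Submodule.sum_mem _ fun j _ => Submodule.sum_mem _ fun l _ => ?_
    by_cases hw : wt wB wC j l = m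
    · exact Submodule.smul_mem _ _ (hvV j l hw)
    · have hZ0 : Z j l = 0 := by
        by_contra hne; exact hw (hZ j l hne)
      rw [hZ0, zero_smul]; exact Submodule.zero_mem _
  refine ⟨fun κ => (D : K)⁻¹ * y' κ, (D : K)⁻¹ • ∑ j, ∑ l, Z j l • vv j l,
    Submodule.smul_mem _ _ hmem, ?_⟩
  have hz : zOf b c k comps (fun κ => (D : K)⁻¹ * y' κ) = (D : K)⁻¹ • zOf b c k comps y' := by
    funext j' l'
    simp only [zOf, Pi.smul_apply, smul_eq_mul, Finset.mul_sum, mul_assoc]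
  rw [hz, ← smul_add, ← hdec, smul_smul, inv_mul_cancel₀ hD, one_smul]

omit [NeZero a] in
/-- A member of `T(A^*)` is an explicit combination of the slices. [folklore] -/
theorem exists_eq_sum_smul_of_mem {b c : ℕ} {t : Fin a → Fin b → Fin c → K} {v : Fin b → Fin c → K}
    (hv : v ∈ sliceSpan t) : ∃ cc : Fin a → K, v = ∑ i, cc i • t i := by
  obtain ⟨cc, hcc⟩ := (Submodule.mem_span_range_iff_exists_fun K).1 hv
  exact ⟨cc, hcc.symm⟩

/-- From `r < bR(T + e_new ⊗ Z(y))` for every `y` with `Z(y) ∉ T(A^*)` to the `hopen` shape of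
the weight-class spine. [cite: JagiellaJelisiejew2026Unrestrictions, Thm. 1.8] -/
theorem hopen_of_zOf {b c k : ℕ} [NeZero b] [NeZero c] {T : Fin a → Fin b → Fin c → ℤ}
    {wA wB wC : List ℕ} {e0 : ℕ} (hhom : homogCheck a b c T wA wB wC e0 = true) {m r : ℕ} {D : ℤ}
    (hD : (D : K) ≠ 0) {C L comps : List (List (List ℤ))}
    (hspan : spanOk a b c k T wB wC m D C L comps = true)
    (hy : ∀ y : Fin k → K, zOf b c k comps y ∉ sliceSpan (fun i j l => ((T i j l : ℤ) : K)) →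
      r < algBorderRank (extendSlice (fun i j l => ((T i j l : ℤ) : K)) (zOf b c k comps y))) :
    ∀ Z : Fin b → Fin c → K, (∀ j l, Z j l ≠ 0 → nget wB j + nget wC l = m) →
      Z ∉ sliceSpan (fun i j l => ((T i j l : ℤ) : K)) →
      r < algBorderRank (extendSlice (fun i j l => ((T i j l : ℤ) : K)) Z) := by
  intro Z hZ hZV
  obtain ⟨y, v, hv, hZe⟩ := exists_eq_zOf_add (K := K) hhom hD hspan Z hZ
  have hyV : zOf b c k comps y ∉ sliceSpan (fun i j l => ((T i j l : ℤ) : K)) := by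
    intro hin
    exact hZV (hZe ▸ Submodule.add_mem _ hin hv)
  obtain ⟨cc, hcc⟩ := exists_eq_sum_smul_of_mem hv
  refine lt_algBorderRank_extendSlice_of_eq_smul_add _ (hy y hyV) (l := 1) (c := cc) ?_ hZV
  rw [one_smul, hZe, hcc]

/-- A certified combination of vanishing polynomials vanishes. [folklore] -/
theorem peval_combo_eq_zero {k : ℕ} (y : Fin k → K) (G Ms : List Poly)
    (hG : ∀ P ∈ G, peval P y = 0) :
    peval (psum ((List.range G.length).map fun g => pmul k (Ms.getD g []) (G.getD g []))) y = 0 := by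
  rw [peval_psum, List.map_map]
  refine List.sum_eq_zero fun x hx => ?_
  obtain ⟨g, hg1, rfl⟩ := List.mem_map.1 hx
  rw [List.mem_range] at hg1
  have hmem : G.getD g [] ∈ G := by
    rw [List.getD_eq_getElem?_getD, List.getElem?_eq_getElem hg1, Option.getD_some]
    exact List.getElem_mem hg1
  simp only [Function.comp_apply, peval_pmul, hG _ hmem, mul_zero]

/-- **Soundness of a `macaulay` class certificate** (output in the `hopen` shape of
`TorusCert.lt_algBorderRank_of_check`). [cite: JagiellaJelisiejew2026Unrestrictions, Thm. 1.8]
[cite: LandsbergOttaviani2015, Thm 2.1] -/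
theorem hopen_of_macClassCheck (K : Type u) [Field K] [CharZero K] {b c : ℕ} [NeZero b] [NeZero c]
    (T : Fin a → Fin b → Fin c → ℤ) {wA wB wC : List ℕ} {e0 : ℕ}
    (hhom : homogCheck a b c T wA wB wC e0 = true) {m r k : ℕ} {D : ℤ}
    {C L comps : List (List (List ℤ))} {roles : List RoleRec} {gens : List GenRec} {N : ℕ}
    {D1 : ℤ} {mults : List (List Poly)}
    (h : macClassCheck a b c T wB wC m r k D C L comps roles gens N D1 mults = true)
    (hD : D ≠ 0) (hD1 : D1 ≠ 0) :
    ∀ Z : Fin b → Fin c → K, (∀ j l, Z j l ≠ 0 → nget wB j + nget wC l = m) →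
      Z ∉ sliceSpan (fun i j l => ((T i j l : ℤ) : K)) →
      r < algBorderRank (extendSlice (fun i j l => ((T i j l : ℤ) : K)) Z) := by
  classical
  unfold macClassCheck at h
  simp only [Bool.and_eq_true] at h
  obtain ⟨⟨⟨hspan, hroles⟩, hgens⟩, hmac⟩ := h
  refine hopen_of_zOf (K := K) hhom (Int.cast_ne_zero.2 hD) hspan fun y hyV => ?_
  by_contra hle
  rw [not_lt] at hle
  have hg := peval_genPoly_eq_zero (K := K) b c k T comps hroles hgens y hle
  -- the Macaulay identities force `y = 0`
  have hG : ∀ P ∈ gens.map (genPoly k b c comps roles), peval P y = 0 := by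
    intro P hP
    obtain ⟨g', hg', rfl⟩ := List.mem_map.1 hP
    exact hg g' hg'
  have hD1K : (D1 : K) ≠ 0 := Int.cast_ne_zero.2 hD1
  have hy0 : y = 0 := by
    funext i
    unfold macOk at hmac
    rw [List.all_eq_true] at hmac
    have hi := hmac i (List.mem_range.2 i.isLt)
    have hz := peval_eq_zero_of_pzero (K := K) hi y
    rw [peval_append, peval_pscale, peval_pscale, peval_combo_eq_zero y _ _ hG, mul_zero, add_zero,
      peval_ppow, peval_cons, peval_nil, add_zero, Int.cast_one, one_mul, mono_eunit] at hz
    exact (pow_eq_zero_iff'.1 ((mul_eq_zero.1 hz).resolve_left hD1K)).1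
  apply hyV
  rw [hy0]
  have : zOf (K := K) b c k comps 0 = 0 := by funext j l; simp [zOf]
  rw [this]; exact Submodule.zero_mem _

/-! ### Points classes -/

/-- Value of the form `h_{q} = P_{i₀} y_q - P_q y_{i₀}`. [folklore] -/
theorem peval_hform {k : ℕ} (P : List ℤ) {i0 q : ℕ} (hi0 : i0 < k) (hq : q < k) (y : Fin k → K) :
    peval (hform k P i0 q) y =
      (P.getD i0 0 : K) * y ⟨q, hq⟩ - (P.getD q 0 : K) * y ⟨i0, hi0⟩ := by
  unfold hform
  rw [peval_plin]
  simp only [Int.cast_sub, apply_ite (Int.cast : ℤ → K), Int.cast_zero, sub_mul,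
    Finset.sum_sub_distrib, ite_mul, zero_mul]
  have e : ∀ (n : ℕ) (hn : n < k) (cc : K),
      ∑ j : Fin k, (if (j : ℕ) = n then cc * y j else 0) = cc * y ⟨n, hn⟩ := by
    intro n hn cc
    rw [Finset.sum_eq_single ⟨n, hn⟩]
    · simp
    · intro j _ hj
      rw [if_neg]
      exact fun h => hj (Fin.ext h)
    · intro h; exact absurd (Finset.mem_univ _) h
  rw [e q hq, e i0 hi0]

/-- From the vanishing of all products of forms over all choices: some point has all its forms
vanishing. [folklore] -/
theorem exists_pt_of_prodForms {k : ℕ} (y : Fin k → K) :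
    ∀ pts : List PtRec, (∀ ch ∈ allChoices k pts, peval (prodForms k pts ch) y = 0) →
      ∃ pt ∈ pts, ∀ q, q < k → q ≠ pt.i0 → peval (hform k pt.P pt.i0 q) y = 0 := by
  intro pts
  induction pts with
  | nil =>
    intro h
    have h0 := h [] (by simp [allChoices])
    simp [prodForms, peval, mono_nil] at h0
  | cons pt pts ih =>
    intro h
    by_cases hpt : ∀ q, q < k → q ≠ pt.i0 → peval (hform k pt.P pt.i0 q) y = 0
    · exact ⟨pt, by simp, hpt⟩
    · push Not at hpt
      obtain ⟨q, hqk, hqi, hqne⟩ := hpt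
      have h' : ∀ ch ∈ allChoices k pts, peval (prodForms k pts ch) y = 0 := by
        intro ch hch
        have hmem : q :: ch ∈ allChoices k (pt :: pts) := by
          simp only [allChoices, List.mem_flatMap, List.mem_filter, List.mem_range, List.mem_map]
          exact ⟨q, ⟨hqk, by simpa using hqi⟩, ch, hch, rfl⟩
        have h1 := h _ hmem
        simp only [prodForms, peval_pmul] at h1
        exact (mul_eq_zero.1 h1).resolve_left hqne
      obtain ⟨pt', hpt', H⟩ := ih h'
      exact ⟨pt', List.mem_cons_of_mem _ hpt', H⟩

/-- **Soundness of a `points` class certificate** (output in the `hopen` shape), given the child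
certificates `r < bR(T + e_new ⊗ z_j)`. [cite: JagiellaJelisiejew2026Unrestrictions, Thm. 1.8]
[cite: LandsbergOttaviani2015, Thm 2.1] -/
theorem hopen_of_ptsClassCheck (K : Type u) [Field K] [CharZero K] {b c : ℕ} [NeZero b] [NeZero c]
    (T : Fin a → Fin b → Fin c → ℤ) {wA wB wC : List ℕ} {e0 : ℕ}
    (hhom : homogCheck a b c T wA wB wC e0 = true) {m r k : ℕ} {D : ℤ}
    {C L comps : List (List (List ℤ))} {roles : List RoleRec} {gens : List GenRec}
    {D1 : ℤ} {pts : List PtRec} {cert : List (List ℕ × ℕ × List Poly)}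
    (h : ptsClassCheck a b c T wB wC m r k D C L comps roles gens D1 pts cert = true)
    (hD : D ≠ 0) (hD1 : D1 ≠ 0)
    (hchild : ∀ pt ∈ pts, r < algBorderRank (fun i j l => ((extendInt T pt.z i j l : ℤ) : K))) :
    ∀ Z : Fin b → Fin c → K, (∀ j l, Z j l ≠ 0 → nget wB j + nget wC l = m) →
      Z ∉ sliceSpan (fun i j l => ((T i j l : ℤ) : K)) →
      r < algBorderRank (extendSlice (fun i j l => ((T i j l : ℤ) : K)) Z) := by
  classical
  unfold ptsClassCheck at h
  simp only [Bool.and_eq_true] at h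
  obtain ⟨⟨⟨hspan, hroles⟩, hgens⟩, hpts⟩ := h
  unfold ptsOk at hpts
  simp only [Bool.and_eq_true] at hpts
  obtain ⟨hpv, hids⟩ := hpts
  set tK : Fin a → Fin b → Fin c → K := fun i j l => ((T i j l : ℤ) : K) with htK
  refine hopen_of_zOf (K := K) hhom (Int.cast_ne_zero.2 hD) hspan fun y hyV => ?_
  by_contra hle
  rw [not_lt] at hle
  have hg := peval_genPoly_eq_zero (K := K) b c k T comps hroles hgens y hle
  have hG : ∀ P ∈ gens.map (genPoly k b c comps roles), peval P y = 0 := by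
    intro P hP
    obtain ⟨g', hg', rfl⟩ := List.mem_map.1 hP
    exact hg g' hg'
  have hD1K : (D1 : K) ≠ 0 := Int.cast_ne_zero.2 hD1
  -- every product of forms vanishes
  have hprod : ∀ ch ∈ allChoices k pts, peval (prodForms k pts ch) y = 0 := by
    intro ch hch
    rw [List.all_eq_true] at hids
    have h1 := hids ch hch
    obtain ⟨ce, _, hce⟩ := List.any_eq_true.1 h1
    simp only [Bool.and_eq_true, beq_iff_eq] at hce
    obtain ⟨_, hz⟩ := hce
    have hz' := peval_eq_zero_of_pzero (K := K) hz y
    rw [peval_append, peval_pscale, peval_pscale, peval_combo_eq_zero y _ _ hG, mul_zero, add_zero,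
      peval_ppow] at hz'
    exact (pow_eq_zero_iff'.1 ((mul_eq_zero.1 hz').resolve_left hD1K)).1
  obtain ⟨pt, hptm, hpt⟩ := exists_pt_of_prodForms y pts hprod
  -- data of the point
  rw [List.all_eq_true] at hpv
  have hp := hpv pt hptm
  simp only [Bool.and_eq_true, decide_eq_true_eq, bne_iff_ne, ne_eq] at hp
  obtain ⟨⟨⟨hi0, hP0⟩, hDz⟩, hzid⟩ := hp
  have hP0K : (pt.P.getD pt.i0 0 : K) ≠ 0 := Int.cast_ne_zero.2 hP0
  have hDzK : (pt.Dz : K) ≠ 0 := Int.cast_ne_zero.2 hDz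
  have hf : ∀ {n : ℕ} [NeZero n] (i : Fin n), finCode n (i : ℕ) = i :=
    fun i => Fin.ext (Nat.mod_eq_of_lt i.isLt)
  -- proportionality `P_{i0} y_q = P_q y_{i0}`
  have hprop : ∀ q : Fin k, (pt.P.getD pt.i0 0 : K) * y q = (pt.P.getD q 0 : K) * y ⟨pt.i0, hi0⟩ := by
    intro q
    by_cases hq : (q : ℕ) = pt.i0
    · have : q = ⟨pt.i0, hi0⟩ := Fin.ext hq
      subst this
      simp [mul_comm]
    · have h1 := hpt q q.isLt hq
      rw [peval_hform pt.P hi0 q.isLt y] at h1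
      exact sub_eq_zero.1 h1
  -- `zOf y = (y_{i0} / P_{i0}) • zdir`, `Dz • z = zdir + ∑ cz_i T_i`
  set zK : Fin b → Fin c → K := fun j l => ((mget pt.z j l : ℤ) : K) with hzK
  let zdir : Fin b → Fin c → K := fun j' l' => ∑ κ : Fin k, (pt.P.getD κ 0 : K) * (mget3 comps κ j' l' : K)
  have hzdir : (pt.Dz : K) • zK = zdir + ∑ i : Fin a, (pt.cz.getD i 0 : K) • tK i := by
    funext j' l'
    have hz1 := of_all_range₂ hzid j' l'
    simp only [beq_iff_eq, lsum_eq, hf] at hz1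
    have hz2 := congrArg (Int.cast : ℤ → K) hz1
    simp only [Int.cast_mul, Int.cast_add, Int.cast_sum] at hz2
    simp only [Pi.smul_apply, smul_eq_mul, Pi.add_apply, Finset.sum_apply, hzK, htK, zdir]
    exact hz2
  have hzOf : zOf b c k comps y = (y ⟨pt.i0, hi0⟩ * (pt.P.getD pt.i0 0 : K)⁻¹) • zdir := by
    funext j' l'
    simp only [zOf, cget, Pi.smul_apply, smul_eq_mul, zdir, Finset.mul_sum]
    refine Finset.sum_congr rfl fun κ _ => ?_
    have hk := hprop κ
    field_simp
    linear_combination (mget3 comps κ j' l' : K) * hk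
  have hchild' : r < algBorderRank (extendSlice tK zK) :=
    (hchild pt hptm).trans_le (algBorderRank_extendInt_le T pt.z)
  have hchild'' : r < algBorderRank (extendSlice tK zdir) := by
    have e1 := algBorderRank_extendSlice_congr tK zK (fun _ => (0 : K)) hDzK
    simp only [zero_smul, Finset.sum_const_zero, add_zero] at e1
    have e2 := algBorderRank_extendSlice_congr tK zdir (fun i => (pt.cz.getD i 0 : K)) one_ne_zero
    rw [one_smul, ← hzdir, e1] at e2
    rw [← e2]; exact hchild'
  have key := lt_algBorderRank_extendSlice_of_eq_smul_add tK hchild''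
    (l := y ⟨pt.i0, hi0⟩ * (pt.P.getD pt.i0 0 : K)⁻¹) (c := fun _ => (0 : K)) (Z := zOf b c k comps y)
    (by rw [hzOf]; simp) hyV
  exact absurd key (not_lt.2 hle)

end ClassSound

end ClassSieve

end Literature.Computability.AlgebraicComplexity
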